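import Literature.Barriers.CriticalPhenomena.PlaquetteWalkYBCurveIdentity
import HarnessLib

/-!
# Barrier catalogue (SAWScalingLimit): COEFFICIENT rigidity of exact plaquette vertex relations on `ℤ²`
— the coefficient vector is a `ρ²`-eigenvector, and the complete list of pairs (weights, coefficients)

Companion of `PlaquetteWalkSpinRigidity` (weight rigidity: an exact vertex relation with `u₁u₂v ≠ 0`,
`c ≠ 0` forces `t¹⁶ = −1` and puts the weights on the curve `ybCurve ε t r` for the sign `ε = ±1` of
SOME nonzero `ρ²`-eigencomponent `(c_E + εc_W, c_N + εc_S)` of the coefficient vector, `r` its ratio),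
`PlaquetteWalkYBClassification` (the same from the row-convex technique class) and
`PlaquetteWalkYBCurveIdentity` (sufficiency on the whole curve at `σ = 5/8`).

New here: the OTHER eigencomponent must vanish. If both `(c_E + c_W, c_N + c_S)` and
`(c_E − c_W, c_N − c_S)` were nonzero, the triangular systems of `rigidity_of_forms` for `ε = +1`
AND `ε = −1` would hold for the same five weights; eliminating `w₁, w₂` and the two ratios leaves
`u₁u₂(t⁴+1) = 2vt²`, `u₁² + u₂² = 1 + v²`, `u₂(u₁ − u₂t²v) = vt⁶(1 − v²)`,
`u₁t⁴(u₁v − u₂t²) = −v(1 − v²)`, whence `(t⁴ + 1)(1 − v²)(t⁸ − t⁴ + 1) = 0` — impossible for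
`t¹⁶ = −1`, `v ≠ 0` (the cases `v = ±1` contradict `R4`). Hence
(`coeff_eigenvector_of_exactPlaquetteVertexRelationRC`) the coefficient vector of every relation with
`u₁u₂v ≠ 0` is `ρ²`-odd (`c_W = −c_E`, `c_S = −c_N`) or `ρ²`-even (`c_W = c_E`, `c_S = c_N`), and
(`pair_rigidity`) `c = c_E · (1, r, ε, εr)` with `W = ybCurve ε t r`, `r = c_N/c_E`: the coefficient
vector is UNIQUE UP TO SCALE for given weights. At `σ = 5/8` this and `PlaquetteWalkYBCurveIdentity`
give the complete solution set (`PlaquetteWalkYBPairClassification_holds`): the pairs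
`(ybCurve ε t r, λ·(1, r, ε, εr))`, `ε = ±1`, `λ ≠ 0`, at the good points `r` of the curve.

Sources: A. Glazman, ECP 20 (2015), Lemma 3.1 and Appendix («the solution is unique»)
[cite: Glazman2015WeightedSAW, Lemma 3.1]; A. Glazman, I. Manolescu, arXiv:1708.00395, Lemma 2.1
(the odd shape `(1, e^{iθ̃}, −1, −e^{iθ̃})` of the printed relation) [cite: GlazmanManolescu2019, Lemma 2.1].
Status in print (venture lane «pcv-sawmu», label cell of record lit-2 g15, 2026-08-23: NEW-IN-WRITING,
modest, provisional): in print the coefficient vector of the rhombus relation is an INPUT fixed by the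
embedding — [cite: IkhlefCardy2009, eq. (1) (arXiv:0810.5037 p. 3: discrete contour integral, coefficients z_j − z_i)],
[cite: Glazman2015WeightedSAW, eq. (3.2) and Lemma 3.1 (ECP 20 no. 86 pp. 5–6)],
[cite: GlazmanManolescu2019, Lemma 2.1, eq. (7) (arXiv v3 p. 7)] — and the weights are solved for; the
converse rigidity of the coefficients proved here is not located in print. Exact-algebra evidence before
the proof: the Gröbner basis of the two triangular systems with `t¹⁶ + 1` and `z·u₁u₂v − 1` is `{1}`
(kit job j191488, sympy 1.14).

Implementation note: the local forms and the algebra are read from the private lemmas `forms`,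
`forms_adj`, `inst_IE/IN/IW/IS` of `PlaquetteWalkYBClassification` and `rigidity_of_forms` of
`PlaquetteWalkSpinRigidity` via `open private … from`; nothing else is opened.

Written for the venture lane «pcv-sawmu» (Tier B; b-engine-1 gen 10).
-/

noncomputable section

namespace Literature.Barriers.CriticalPhenomena.PlaquetteWalk

open Literature.Probability.RandomPlanarGeometry.SAW.YangBaxter Real Complex

open private forms forms_adj inst_IE inst_IN inst_IW inst_IS from
  Literature.Barriers.CriticalPhenomena.PlaquetteWalkYBClassification
open private rigidity_of_forms from Literature.Barriers.CriticalPhenomena.PlaquetteWalkSpinRigidity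

/-- **The two triangular systems are inconsistent.** If the conclusions of `rigidity_of_forms` held
for `ε = +1` with the component `(a, b)` AND for `ε = −1` with the component `(a', b')`, all four
nonzero, for one weight system with `u₁ v ≠ 0` and `t¹⁶ = −1`, then eliminating `w₂, w₁` (`R1±`,
`R2±`) and `b, b'` (`R3±`) from `R4±` gives `u₁u₂(t⁴+1) = 2vt²`, `u₁² + u₂² = 1 + v²`,
`u₂(u₁ − u₂t²v) = vt⁶(1−v²)`, `u₁t⁴(u₁v − u₂t²) = −v(1−v²)`, hence
`(t⁴+1)(1−v²)(t⁸−t⁴+1) = 0`: `t⁴ = −1` and `t⁸ − t⁴ + 1 = 0` contradict `t¹⁶ = −1`, and `v = ±1`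
contradicts `R4∓`. [folklore] -/
private theorem no_two_components {u₁ u₂ v w₁ w₂ t a b a' b' : ℂ} (ht : t ≠ 0) (h16 : t ^ 16 = -1)
    (h1 : u₁ ≠ 0) (hv : v ≠ 0) (ha : a ≠ 0) (hb : b ≠ 0) (ha' : a' ≠ 0) (hb' : b' ≠ 0)
    (hR4p : u₁ * a * b * (t ^ 4 - 1) = t * (1 + v) * (b ^ 2 - t ^ 2 * a ^ 2))
    (hR3p : u₂ * t ^ 2 * a = -u₁ * a - t * (1 + v) * b)
    (hR2p : w₁ * t ^ 4 * a = -v * a - u₁ * t ^ 5 * b)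
    (hR1p : w₂ * t * a = -v * t ^ 5 * a - u₂ * b)
    (hR4m : -u₁ * a' * b' * (t ^ 4 - 1) = t * (1 - v) * (b' ^ 2 - t ^ 2 * a' ^ 2))
    (hR3m : u₂ * t ^ 2 * a' = u₁ * a' - t * (1 - v) * b')
    (hR2m : w₁ * t ^ 4 * a' = v * a' + u₁ * t ^ 5 * b')
    (hR1m : w₂ * t * a' = v * t ^ 5 * a' - u₂ * b') : False := by
  have ht4 : t ^ 4 ≠ 1 := by
    intro h4
    have : t ^ 16 = 1 := by
      calc t ^ 16 = (t ^ 4) ^ 4 := by ring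
        _ = 1 := by rw [h4]; norm_num
    rw [h16] at this; norm_num at this
  -- (E3)/(E4): eliminate `b, b'` from `R4±` with `R3±`
  have C1 : a ^ 2 * (u₁ * (t ^ 4 - 1) * (u₁ + u₂ * t ^ 2) + (u₁ + u₂ * t ^ 2) ^ 2
      - t ^ 4 * (1 + v) ^ 2) = 0 := by
    linear_combination (-(t * (1 + v))) * hR4p
      + (u₁ * a * (t ^ 4 - 1) + 2 * a * (u₁ + u₂ * t ^ 2)
          - (u₂ * t ^ 2 * a + u₁ * a + t * (1 + v) * b)) * hR3p
  have C2 : a' ^ 2 * (u₁ * (t ^ 4 - 1) * (u₁ - u₂ * t ^ 2) + (u₁ - u₂ * t ^ 2) ^ 2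
      - t ^ 4 * (1 - v) ^ 2) = 0 := by
    linear_combination (-(t * (1 - v))) * hR4m
      - (u₁ * a' * (t ^ 4 - 1) + 2 * a' * (u₁ - u₂ * t ^ 2)
          + (u₂ * t ^ 2 * a' - u₁ * a' + t * (1 - v) * b')) * hR3m
  have e3 : u₁ * (t ^ 4 - 1) * (u₁ + u₂ * t ^ 2) + (u₁ + u₂ * t ^ 2) ^ 2 - t ^ 4 * (1 + v) ^ 2 = 0 := by
    rcases mul_eq_zero.1 C1 with h | h
    · exact absurd (pow_eq_zero_iff two_ne_zero |>.1 h) ha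
    · exact h
  have e4 : u₁ * (t ^ 4 - 1) * (u₁ - u₂ * t ^ 2) + (u₁ - u₂ * t ^ 2) ^ 2 - t ^ 4 * (1 - v) ^ 2 = 0 := by
    rcases mul_eq_zero.1 C2 with h | h
    · exact absurd (pow_eq_zero_iff two_ne_zero |>.1 h) ha'
    · exact h
  -- (E5): `u₁u₂(t⁴+1) = 2vt²`; (E6): `u₁² + u₂² = 1 + v²`
  have E5 : u₁ * u₂ * (t ^ 4 + 1) - 2 * v * t ^ 2 = 0 := by
    have h : 2 * t ^ 2 * (u₁ * u₂ * (t ^ 4 + 1) - 2 * v * t ^ 2) = 0 := by linear_combination e3 - e4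
    rcases mul_eq_zero.1 h with h | h
    · exact absurd h (mul_ne_zero two_ne_zero (pow_ne_zero 2 ht))
    · exact h
  have E6 : u₁ ^ 2 + u₂ ^ 2 - 1 - v ^ 2 = 0 := by
    have h : 2 * t ^ 4 * (u₁ ^ 2 + u₂ ^ 2 - 1 - v ^ 2) = 0 := by linear_combination e3 + e4
    rcases mul_eq_zero.1 h with h | h
    · exact absurd h (mul_ne_zero two_ne_zero (pow_ne_zero 4 ht))
    · exact h
  -- (i'), (ii'): eliminate `w₂, w₁`
  have hi : u₂ * (a * b' - a' * b) = 2 * v * t ^ 5 * a * a' := by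
    linear_combination (-a') * hR1p + a * hR1m
  have hii : u₁ * t ^ 5 * (a' * b + a * b') = -2 * v * a * a' := by
    linear_combination a' * hR2p - a * hR2m
  -- (E1'), (E2')
  have C3 : 2 * a * a' * t * (u₂ * (u₁ - u₂ * t ^ 2 * v) - v * t ^ 6 * (1 - v ^ 2)) = 0 := by
    linear_combination (t ^ 2 * (1 - v ^ 2)) * hi - (u₂ * t * a * (1 + v)) * hR3m
      + (u₂ * t * a' * (1 - v)) * hR3p
  have C4 : 2 * a * a' * t ^ 2 * (u₁ * t ^ 4 * (u₁ * v - u₂ * t ^ 2) + v * (1 - v ^ 2)) = 0 := by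
    linear_combination (t ^ 2 * (1 - v ^ 2)) * hii - (u₁ * t ^ 6 * a' * (1 - v)) * hR3p
      - (u₁ * t ^ 6 * a * (1 + v)) * hR3m
  have haa't : 2 * a * a' * t ≠ 0 := mul_ne_zero (mul_ne_zero (mul_ne_zero two_ne_zero ha) ha') ht
  have E1 : u₂ * (u₁ - u₂ * t ^ 2 * v) - v * t ^ 6 * (1 - v ^ 2) = 0 := by
    rcases mul_eq_zero.1 C3 with h | h
    · exact absurd h haa't
    · exact h
  have haa't2 : 2 * a * a' * t ^ 2 ≠ 0 :=
    mul_ne_zero (mul_ne_zero (mul_ne_zero two_ne_zero ha) ha') (pow_ne_zero 2 ht)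
  have E2 : u₁ * t ^ 4 * (u₁ * v - u₂ * t ^ 2) + v * (1 - v ^ 2) = 0 := by
    rcases mul_eq_zero.1 C4 with h | h
    · exact absurd h haa't2
    · exact h
  -- final elimination: `v t² (t⁴+1)(1−v²)(t⁸−t⁴+1) = 0`
  have FIN : v * t ^ 2 * ((t ^ 4 + 1) * (1 - v ^ 2) * (t ^ 8 - t ^ 4 + 1)) = 0 := by
    linear_combination (t ^ 2 * (t ^ 4 + 1)) * E2 + (t ^ 8 + t ^ 4) * E5 - (t ^ 4 * (t ^ 4 + 1)) * E1
      - (v * t ^ 6 * (t ^ 4 + 1)) * E6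
  have hvt : v * t ^ 2 ≠ 0 := mul_ne_zero hv (pow_ne_zero 2 ht)
  rcases mul_eq_zero.1 FIN with h | h
  · exact hvt h
  rcases mul_eq_zero.1 h with h | h
  · rcases mul_eq_zero.1 h with h | h
    · -- `t⁴ = −1` contradicts `t¹⁶ = −1`
      have h4 : t ^ 4 = -1 := by linear_combination h
      have : t ^ 16 = 1 := by
        calc t ^ 16 = (t ^ 4) ^ 4 := by ring
          _ = 1 := by rw [h4]; norm_num
      rw [h16] at this; norm_num at this
    · -- `v² = 1`
      have hv1 : (v - 1) * (v + 1) = 0 := by linear_combination -h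
      rcases mul_eq_zero.1 hv1 with h | h
      · have hv' : v = 1 := by linear_combination h
        subst hv'
        have : u₁ * a' * b' * (t ^ 4 - 1) = 0 := by linear_combination -hR4m
        rcases mul_eq_zero.1 this with h | h
        · exact absurd h (mul_ne_zero (mul_ne_zero h1 ha') hb')
        · exact ht4 (by linear_combination h)
      · have hv' : v = -1 := by linear_combination h
        subst hv'
        have : u₁ * a * b * (t ^ 4 - 1) = 0 := by linear_combination hR4p
        rcases mul_eq_zero.1 this with h | h
        · exact absurd h (mul_ne_zero (mul_ne_zero h1 ha) hb)
        · exact ht4 (by linear_combination h)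
  · -- `t⁸ − t⁴ + 1 = 0` contradicts `t¹⁶ = −1`
    have : (1 : ℂ) = 0 := by linear_combination (1 - t ^ 12 - t ^ 8) * h + t ^ 4 * h16
    exact one_ne_zero this

variable {W : CWeights} {t : ℂ} {c : Fin 4 → ℂ}

/-- **Coefficient rigidity: the coefficient vector is a `ρ²`-eigenvector.** For a weight system with
`u₁u₂v ≠ 0` (`t ≠ 0`), the coefficient vector `c = (c_E, c_N, c_W, c_S)` of an exact vertex relation on
all row-convex face lists is `ρ²`-ODD (`c_E + c_W = 0 = c_N + c_S`) or `ρ²`-EVEN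
(`c_E − c_W = 0 = c_N − c_S`). [cite: Glazman2015WeightedSAW, Lemma 3.1, Appendix («the solution is unique»)] -/
theorem coeff_eigenvector_of_exactPlaquetteVertexRelationRC (hrel : ExactPlaquetteVertexRelationRC W t c)
    (ht : t ≠ 0) (h1 : W.u₁ ≠ 0) (h2 : W.u₂ ≠ 0) (hv : W.v ≠ 0) :
    (c 0 + c 2 = 0 ∧ c 1 + c 3 = 0) ∨ (c 0 - c 2 = 0 ∧ c 1 - c 3 = 0) := by
  by_contra H
  have habp : c 0 + 1 * c 2 ≠ 0 ∨ c 1 + 1 * c 3 ≠ 0 := by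
    by_contra h'
    push Not at h'
    exact H (Or.inl ⟨by linear_combination h'.1, by linear_combination h'.2⟩)
  have habm : c 0 + (-1) * c 2 ≠ 0 ∨ c 1 + (-1) * c 3 ≠ 0 := by
    by_contra h'
    push Not at h'
    exact H (Or.inr ⟨by linear_combination h'.1, by linear_combination h'.2⟩)
  have hc : c ≠ 0 := by
    rintro rfl
    simp at habp
  have h16 := t_pow_sixteen_of_exactPlaquetteVertexRelationRC hrel ht h1 h2 hv hc
  obtain ⟨fA1, fA1', fB1, fB1', -, -⟩ := forms hrel ht h1 h2 hv
  obtain ⟨fC1, fC1', fE1, fE1'⟩ := forms_adj hrel ht h1 h2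
  obtain ⟨ha, hb, -, -, hR4p, hR3p, hR2p, hR1p⟩ := rigidity_of_forms ht h2 h16 (inst_IE hrel ht)
    (inst_IN hrel ht) (inst_IW hrel ht) (inst_IS hrel ht) fA1 fA1' fB1 fB1' fC1 fC1' fE1 fE1'
    (Or.inl rfl) habp
  obtain ⟨ha', hb', -, -, hR4m, hR3m, hR2m, hR1m⟩ := rigidity_of_forms ht h2 h16 (inst_IE hrel ht)
    (inst_IN hrel ht) (inst_IW hrel ht) (inst_IS hrel ht) fA1 fA1' fB1 fB1' fC1 fC1' fE1 fE1'
    (Or.inr rfl) habm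
  exact no_two_components (u₂ := W.u₂) (w₁ := W.w₁) (w₂ := W.w₂) ht h16 h1 hv ha hb ha' hb'
    (by linear_combination hR4p)
    (by linear_combination hR3p) (by linear_combination hR2p) (by linear_combination hR1p)
    (by linear_combination hR4m) (by linear_combination hR3m) (by linear_combination hR2m)
    (by linear_combination hR1m)

/-- The `(ε, r)`-coefficient vector `(1, r, ε, εr)` (`ε = −1`: `oddCoeff r`; `ε = +1`: the even vector,
a multiple of `gaugeCoeff (oddCoeff r)`). [cite: GlazmanManolescu2019, Lemma 2.1, eq. (CR)] -/
def epsCoeff (ε r : ℂ) : Fin 4 → ℂ := ![1, r, ε, ε * r]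

/-- `epsCoeff (−1) r = oddCoeff r`. [cite: GlazmanManolescu2019, Lemma 2.1, eq. (CR)] -/
theorem epsCoeff_neg_one (r : ℂ) : epsCoeff (-1) r = oddCoeff r := by
  funext i
  fin_cases i <;> simp [epsCoeff, oddCoeff]

/-- `epsCoeff 1 r = −gaugeCoeff (oddCoeff r)`. [cite: Glazman2015WeightedSAW, Lemma 3.1 (symmetries of the local system)] -/
theorem epsCoeff_one (r : ℂ) : epsCoeff 1 r = -gaugeCoeff (oddCoeff r) := by
  funext i
  fin_cases i <;> simp [epsCoeff, oddCoeff, gaugeCoeff]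

/-- **Pair rigidity**: for a relation with `u₁u₂v ≠ 0`, `c ≠ 0` (`t ≠ 0`) there are a sign `ε = ±1`
and a ratio `r` with `W = ybCurve ε t r`, `c_E ≠ 0` and `c = c_E · (1, r, ε, εr)` — the coefficient
vector is unique up to scale for the given weights (`r = c_N / c_E`).
[cite: Glazman2015WeightedSAW, Lemma 3.1, Appendix («the solution is unique»)] -/
theorem pair_rigidity (hrel : ExactPlaquetteVertexRelationRC W t c) (ht : t ≠ 0) (h1 : W.u₁ ≠ 0)
    (h2 : W.u₂ ≠ 0) (hv : W.v ≠ 0) (hc : c ≠ 0) :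
    ∃ ε r : ℂ, (ε = 1 ∨ ε = -1) ∧ W = ybCurve ε t r ∧ c 0 ≠ 0 ∧ c = fun i => c 0 * epsCoeff ε r i := by
  obtain ⟨ε, hε, ha, hW⟩ := weights_eq_ybCurveRC hrel ht h1 h2 hv hc
  have hpar := coeff_eigenvector_of_exactPlaquetteVertexRelationRC hrel ht h1 h2 hv
  -- the sign of the nonzero component is the parity of `c`
  have key : c 2 = ε * c 0 ∧ c 3 = ε * c 1 := by
    rcases hε with rfl | rfl <;> rcases hpar with ⟨h0, h1'⟩ | ⟨h0, h1'⟩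
    · exact absurd (by linear_combination h0) ha
    · exact ⟨by linear_combination -h0, by linear_combination -h1'⟩
    · exact ⟨by linear_combination h0, by linear_combination h1'⟩
    · exact absurd (by linear_combination h0) ha
  have hc0 : c 0 ≠ 0 := by
    intro h0
    apply ha
    rw [key.1, h0]
    ring
  have hratio : (c 1 + ε * c 3) / (c 0 + ε * c 2) = c 1 / c 0 := by
    rw [div_eq_div_iff ha hc0, key.1, key.2]
    ring
  refine ⟨ε, c 1 / c 0, hε, ?_, hc0, ?_⟩
  · rw [hW, hratio]
  · funext i
    fin_cases i
    · simp [epsCoeff]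
    · simp only [epsCoeff]
      show c 1 = c 0 * (c 1 / c 0)
      field_simp
    · simp only [epsCoeff]
      show c 2 = c 0 * ε
      rw [key.1]; ring
    · simp only [epsCoeff]
      show c 3 = c 0 * (ε * (c 1 / c 0))
      rw [key.2]; field_simp

/-- **Named statement `PlaquetteWalkYBPairClassification`** — the complete solution set at `σ = 5/8`
(`t = e^{−5iπ/16}`), one technique class on both sides: for `u₁u₂v ≠ 0` and `c ≠ 0`,
`ExactPlaquetteVertexRelationRC W t c` holds iff `W = ybCurve ε t r` and `c = c_E · (1, r, ε, εr)`
(`c_E ≠ 0`) for a sign `ε = ±1` and a ratio `r ∈ ℂ`.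
[cite: GlazmanManolescu2019, eq. (1), Lemma 2.1] [cite: Glazman2015WeightedSAW, Lemma 3.1] -/
def _root_.Literature.Barriers.CriticalPhenomena.PlaquetteWalkYBPairClassification : Prop :=
  ∀ (W : CWeights) (c : Fin 4 → ℂ), W.u₁ ≠ 0 → W.u₂ ≠ 0 → W.v ≠ 0 → c ≠ 0 →
    (ExactPlaquetteVertexRelationRC W tFiveEighths c ↔
      ∃ ε r : ℂ, (ε = 1 ∨ ε = -1) ∧ W = ybCurve ε tFiveEighths r ∧ c 0 ≠ 0 ∧
        c = fun i => c 0 * epsCoeff ε r i)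

/-- A scalar multiple of a relation's coefficient vector is again one. [cite: DuminilCopinSmirnov2012, Lemma 1 (shape of the relation)] -/
private theorem exactPlaquetteVertexRelationRC_smul {W : CWeights} {t : ℂ} {c : Fin 4 → ℂ} (μ : ℂ)
    (h : ExactPlaquetteVertexRelationRC W t c) :
    ExactPlaquetteVertexRelationRC W t (fun i => μ * c i) := by
  intro Dl a f₀ hD hf ha
  have h0 := h Dl a f₀ hD hf ha
  unfold vertexFunctional at h0 ⊢
  beta_reduce
  calc ∑ s : Fin 4, μ * c s * gmObservable W t Dl a (slotSide f₀ s)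
      = μ * ∑ s : Fin 4, c s * gmObservable W t Dl a (slotSide f₀ s) := by
        rw [Finset.mul_sum]; exact Finset.sum_congr rfl fun s _ => by ring
    _ = 0 := by rw [h0, mul_zero]

/-- **`PlaquetteWalkYBPairClassification` holds.** (→) `pair_rigidity`; (←) the curve identity
(`exactPlaquetteVertexRelationRC_ybCurve`, `…_one`) scaled by `c_E` (resp. `−c_E` on the even side),
the side conditions on `r` following from `u₁ ≠ 0`, `v ≠ 0`.
[cite: GlazmanManolescu2019, eq. (1), Lemma 2.1] [cite: Glazman2015WeightedSAW, Lemma 3.1] -/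
theorem _root_.Literature.Barriers.CriticalPhenomena.PlaquetteWalkYBPairClassification_holds :
    PlaquetteWalkYBPairClassification := by
  intro W c h1 h2 hv hc
  constructor
  · intro hrel
    exact pair_rigidity hrel tFiveEighths_ne_zero h1 h2 hv hc
  · rintro ⟨ε, r, hε, hW, hc0, hcdef⟩
    -- the good-point conditions from `u₁ ≠ 0`, `v ≠ 0`
    have hr : r ≠ 0 := by
      rintro rfl; rw [hW] at h1; exact h1 (by simp [ybCurve, ybU1])
    have hD : tFiveEighths ^ 6 * (1 + r ^ 4) - (1 + tFiveEighths ^ 12) * r ^ 2 ≠ 0 := by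
      intro h; rw [hW] at hv; exact hv (show ybV ε tFiveEighths r = 0 by rw [ybV, h, div_zero])
    rcases hε with rfl | rfl
    · -- even side: `c = c_E · (1, r, 1, r) = (−c_E) · gaugeCoeff (oddCoeff r)`
      have hrelg := exactPlaquetteVertexRelationRC_smul (-c 0)
        (exactPlaquetteVertexRelationRC_ybCurve_one hr hD)
      have hceq : (fun i => c 0 * epsCoeff 1 r i) = (fun i => -c 0 * gaugeCoeff (oddCoeff r) i) := by
        funext i
        rw [epsCoeff_one, Pi.neg_apply]
        ring
      rw [hW, hcdef, hceq]
      exact hrelg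
    · have hrelg := exactPlaquetteVertexRelationRC_smul (c 0)
        (exactPlaquetteVertexRelationRC_ybCurve hr hD)
      have hceq : (fun i => c 0 * epsCoeff (-1) r i) = (fun i => c 0 * oddCoeff r i) := by
        rw [epsCoeff_neg_one]
      rw [hW, hcdef, hceq]
      exact hrelg

end Literature.Barriers.CriticalPhenomena.PlaquetteWalk
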